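import Summits.RiemannHypothesis.RiemannHypothesis.Theorems.PfPersistenceGalerkinTestDensity
import Summits.RiemannHypothesis.RiemannHypothesis.Theorems.PfPersistenceInWindowMirror
import HarnessLib

/-!
# PF persistence — GAL-2 part A: NESTING of the truncation ladder and `ε₁^{(N)}(a) ↓ ε_ev(a)`
(pub-rhpf, cand-3 gen 8; CASE-DAG §6 GAL-2, lead SEAT-BRIEFS-batch2 §S5)

**HONEST FRAMING. This is a long-odds MECHANISM / RIGIDITY campaign; no RH claims.** Everything in this
file is RH-free and unconditional: finite-dimensional linear algebra about the even blocks
`datumOf w ⟨a, N, ha⟩` of a truncated Weil form (any weight table `w`), plus — AT `ζ` — the transfer of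
uniform Galerkin floors to the continuum even ground energy `ε_ev(a) = weilEvenGroundEnergy a` through
the tree's PROVED density `testToGalerkinFormDensity` (GAL-1 (ii″)) and PROVED Rayleigh–Ritz bound
`ε_ev(a) ≤ ε₁^{(N)}(a)` (`weilEvenGroundEnergy_le_bottomRayleigh'`, GAL-0). Labels: every
statement below is PROVED; no DATA enters.

* §1 NESTING (PROVED, every weight table): the block at rank `N` is the leading principal
  `(N+1) × (N+1)` corner of the block at rank `N+1` (`datumOf_succ_castSucc`), so zero-padding a window
  vector preserves the quadratic form and the mass (`datumOf_form_snoc_zero`, `snoc_zero_dotProduct`);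
  hence the Rayleigh sets are nested and the served bottom Rayleigh value is ANTITONE in the truncation
  rank: `ε₁^{(N+1)}(a) ≤ ε₁^{(N)}(a)` (`bottomRayleigh_succ_le`, `bottomRayleigh_antitone`).
* §2 UNIFORM FLOORS TRANSFER WITHOUT A SIGN (PROVED, at `ζ`): a floor `c · vᵀv ≤ vᵀ(ζ-block at (a, N))v`
  for EVERY truncation `N` gives `c · ∫|g|² ≤ Re Q(g)` for smooth even real tests in `[-a, a]`
  (`re_weilQuadratic_ge_of_uniform_floor`) and `c ≤ ε_ev(a)` (`le_weilEvenGroundEnergy_of_uniform_floor`);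
  this removes the restriction `c = -σ ≤ 0` of `neg_le_weilEvenGroundEnergy_of_galerkinFloorAt`.
* §3 CONVERGENCE (PROVED, at `ζ`): `ε₁^{(N)}(a) → ε_ev(a)` as `N → ∞`, monotonically from above
  (`tendsto_bottomRayleigh_weilEvenGroundEnergy`), and `⨅_N ε₁^{(N)}(a) = ε_ev(a)`
  (`iInf_bottomRayleigh_eq_weilEvenGroundEnergy`): the served `eps1_even(a, N)` ladder is a certified
  decreasing sequence of UPPER bounds converging to the continuum even ground energy. This is the
  energy half of GAL-2 ("Galerkin bottom eigenpairs converge to the continuum ground state"); the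
  eigenVECTOR half (one-signed served bottom vectors at unboundedly many `N` ⇒ a one-signed continuum even
  ground state at `a`) is the companion file `PfPersistenceGalerkinGroundStateLimit`.

What this does NOT say: nothing about the sign of `ε_ev(a)` (that is RH-strength, sink
`PfPersistenceNonvanishingSink`), nothing about rates in `N`.
-/

set_option linter.dupNamespace false  -- the mandated namespace repeats `RiemannHypothesis`

noncomputable section

open Set MeasureTheory Matrix Filter
open scoped Topology
open Literature.NumberTheory.LFunctions

namespace Summit.RiemannHypothesis.RiemannHypothesis.Theorems.PfPersistence

/-! ## §1 Nesting of the even blocks in the truncation rank; `ε₁^{(N)}` is antitone in `N` -/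

/-- PROVED (every weight table): the rank-`N+1` block restricted to the first `N+1` indices is the rank-`N`
block — the matrix entries `W(Θ^even_{nm})` do not depend on the truncation. [folklore] -/
theorem datumOf_succ_castSucc (w : Weights) (a : ℝ) (ha : 0 < a) (N : ℕ) (n m : Fin (N + 1)) :
    datumOf w ⟨a, N + 1, ha⟩ n.castSucc m.castSucc = datumOf w ⟨a, N, ha⟩ n m := rfl

/-- PROVED: as a submatrix statement. [folklore] -/
theorem datumOf_submatrix_castSucc (w : Weights) (a : ℝ) (ha : 0 < a) (N : ℕ) :
    (datumOf w ⟨a, N + 1, ha⟩).submatrix Fin.castSucc Fin.castSucc = datumOf w ⟨a, N, ha⟩ := by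
  ext n m
  exact datumOf_succ_castSucc w a ha N n m

/-- PROVED: zero-padding preserves the Euclidean mass. [folklore] -/
theorem snoc_zero_dotProduct {N : ℕ} (v u : Fin (N + 1) → ℝ) :
    (Fin.snoc v 0 : Fin (N + 1 + 1) → ℝ) ⬝ᵥ (Fin.snoc u 0 : Fin (N + 1 + 1) → ℝ) = v ⬝ᵥ u := by
  simp [dotProduct, Fin.sum_univ_castSucc, Fin.snoc_castSucc, Fin.snoc_last]

/-- PROVED: the quadratic form of a zero-padded vector is the form of the leading principal corner. [folklore] -/
theorem snoc_zero_form {N : ℕ} (M : Matrix (Fin (N + 1 + 1)) (Fin (N + 1 + 1)) ℝ) (v : Fin (N + 1) → ℝ) :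
    (Fin.snoc v 0 : Fin (N + 1 + 1) → ℝ) ⬝ᵥ (M *ᵥ (Fin.snoc v 0 : Fin (N + 1 + 1) → ℝ)) =
      v ⬝ᵥ (M.submatrix Fin.castSucc Fin.castSucc *ᵥ v) := by
  simp [dotProduct, Matrix.mulVec, Fin.sum_univ_castSucc, Fin.snoc_castSucc, Fin.snoc_last,
    Matrix.submatrix_apply]

/-- PROVED (every weight table): zero-padding a rank-`N` window vector preserves the quadratic form of the
even block. [folklore] -/
theorem datumOf_form_snoc_zero (w : Weights) (a : ℝ) (ha : 0 < a) (N : ℕ) (v : Fin (N + 1) → ℝ) :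
    (Fin.snoc v 0 : Fin (N + 1 + 1) → ℝ) ⬝ᵥ (datumOf w ⟨a, N + 1, ha⟩ *ᵥ (Fin.snoc v 0 : Fin (N + 1 + 1) → ℝ)) =
      v ⬝ᵥ (datumOf w ⟨a, N, ha⟩ *ᵥ v) := by
  rw [snoc_zero_form, datumOf_submatrix_castSucc]

/-- PROVED: zero-padding a nonzero vector gives a nonzero vector. [folklore] -/
theorem snoc_zero_ne_zero {N : ℕ} {v : Fin (N + 1) → ℝ} (hv : v ≠ 0) :
    (Fin.snoc v 0 : Fin (N + 1 + 1) → ℝ) ≠ 0 := by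
  intro h
  apply hv
  funext i
  have := congr_fun h i.castSucc
  simpa [Fin.snoc_castSucc] using this

/-- PROVED (every weight table): the Rayleigh sets are NESTED along the truncation ladder. [folklore] -/
theorem rayleighSet_subset_succ (w : Weights) (a : ℝ) (ha : 0 < a) (N : ℕ) :
    rayleighSet (datumOf w ⟨a, N, ha⟩) ⊆ rayleighSet (datumOf w ⟨a, N + 1, ha⟩) := by
  rintro r ⟨v, hv, rfl⟩
  exact ⟨Fin.snoc v 0, snoc_zero_ne_zero hv, by rw [datumOf_form_snoc_zero, snoc_zero_dotProduct]⟩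

/-- **PROVED — `ε₁^{(N+1)}(a) ≤ ε₁^{(N)}(a)`** (every weight table): enlarging the truncation can only lower
the bottom Rayleigh value. [folklore] -/
theorem bottomRayleigh_succ_le (w : Weights) (a : ℝ) (ha : 0 < a) (N : ℕ) :
    bottomRayleigh (datumOf w ⟨a, N + 1, ha⟩) ≤ bottomRayleigh (datumOf w ⟨a, N, ha⟩) := by
  rw [bottomRayleigh_eq_sInf, bottomRayleigh_eq_sInf]
  exact csInf_le_csInf (rayleighSet_bddBelow _) (rayleighSet_nonempty _) (rayleighSet_subset_succ w a ha N)

/-- **PROVED — the served bottom Rayleigh value is ANTITONE in the truncation rank** (every weight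
table). [folklore] -/
theorem bottomRayleigh_antitone (w : Weights) (a : ℝ) (ha : 0 < a) :
    Antitone fun N : ℕ ↦ bottomRayleigh (datumOf w ⟨a, N, ha⟩) :=
  antitone_nat_of_succ_le fun N ↦ bottomRayleigh_succ_le w a ha N

/-- PROVED: the same at `ζ` (`zetaDatum = datumOf zetaWeights`). [folklore] -/
theorem zeta_bottomRayleigh_antitone (a : ℝ) (ha : 0 < a) :
    Antitone fun N : ℕ ↦ bottomRayleigh (zetaDatum ⟨a, N, ha⟩) :=
  bottomRayleigh_antitone zetaWeights a ha

/-- PROVED: monotonicity in the form used below, `N₀ ≤ N ⇒ ε₁^{(N)}(a) ≤ ε₁^{(N₀)}(a)` at `ζ`. [folklore] -/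
theorem zeta_bottomRayleigh_le_of_le {a : ℝ} (ha : 0 < a) {N₀ N : ℕ} (h : N₀ ≤ N) :
    bottomRayleigh (zetaDatum ⟨a, N, ha⟩) ≤ bottomRayleigh (zetaDatum ⟨a, N₀, ha⟩) :=
  zeta_bottomRayleigh_antitone a ha h

/-! ## §2 Uniform Galerkin floors of either sign transfer to the continuum even ground energy (at `ζ`) -/

/-- **PROVED — UNIFORM GALERKIN FLOORS TRANSFER TO SMOOTH EVEN REAL TESTS, any sign of the floor.** If
`c · vᵀv ≤ vᵀ(ζ-block at (a, N))v` for every truncation `N` and every `v`, then `c · ∫|g|² ≤ Re Q(g)` for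
every smooth even real test `g` supported in `[-a, a]`. Proof: the PROVED density
`testToGalerkinFormDensity` with the two-sided mass bound (no sign of `c` needed). [folklore] -/
theorem re_weilQuadratic_ge_of_uniform_floor {a c : ℝ} {ha : 0 < a}
    (hfl : ∀ (N : ℕ) (v : Fin (N + 1) → ℝ), c * (v ⬝ᵥ v) ≤ v ⬝ᵥ (zetaDatum ⟨a, N, ha⟩ *ᵥ v))
    {g : ℝ → ℂ} (hg : IsWeilTest g) (hs : tsupport g ⊆ Icc (-a) a) (hev : ∀ t, g (-t) = g t)
    (hre : ∀ t, (g t).im = 0) : c * ∫ t, ‖g t‖ ^ 2 ≤ (weilQuadratic g).re := by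
  refine le_of_forall_pos_le_add fun ε hε => ?_
  have hM : 0 < |c| + 1 := by positivity
  obtain ⟨N, v, hn, hq⟩ := testToGalerkinFormDensity a ha g hg hs hev hre (ε / (|c| + 1)) (div_pos hε hM)
  have hf := hfl N v
  have hcm : |c * (v ⬝ᵥ v) - c * ∫ t, ‖g t‖ ^ 2| ≤ |c| * (ε / (|c| + 1)) := by
    rw [← mul_sub, abs_mul]
    exact mul_le_mul_of_nonneg_left hn (abs_nonneg c)
  have h1 := (abs_le.1 hcm).1
  have hq' := (abs_le.1 hq).2
  have hδ : |c| * (ε / (|c| + 1)) + ε / (|c| + 1) = ε := by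
    field_simp
  linarith

/-- **PROVED — UNIFORM GALERKIN FLOORS BOUND THE CONTINUUM EVEN GROUND ENERGY FROM BELOW, any sign:**
`(∀ N v, c · vᵀv ≤ vᵀ(ζ-block at (a, N))v) ⇒ c ≤ ε_ev(a)`. The real/imaginary decoupling
`re_weilQuadratic_eq_re_add_im` reduces the complex even tests of `weilEvenGroundEnergy` to real ones. [folklore] -/
theorem le_weilEvenGroundEnergy_of_uniform_floor {a c : ℝ} (ha : 0 < a)
    (hfl : ∀ (N : ℕ) (v : Fin (N + 1) → ℝ), c * (v ⬝ᵥ v) ≤ v ⬝ᵥ (zetaDatum ⟨a, N, ha⟩ *ᵥ v)) :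
    c ≤ weilEvenGroundEnergy a := by
  refine le_weilEvenGroundEnergy_of_forall ha fun g hg hs hev hn => ?_
  rw [re_weilQuadratic_eq_re_add_im hg]
  have h₁ := re_weilQuadratic_ge_of_uniform_floor hfl (isWeilTest_ofReal_re hg)
    ((tsupport_ofReal_re_subset g).trans hs) (fun t => by simp [hev t]) (fun t => Complex.ofReal_im _)
  have h₂ := re_weilQuadratic_ge_of_uniform_floor hfl (isWeilTest_ofReal_im hg)
    ((tsupport_ofReal_im_subset g).trans hs) (fun t => by simp [hev t]) (fun t => Complex.ofReal_im _)
  have hsum := integral_norm_sq_eq_re_add_im hg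
  rw [hn] at hsum
  have hc : c * (∫ t, ‖(((g t).re : ℝ) : ℂ)‖ ^ 2) + c * (∫ t, ‖(((g t).im : ℝ) : ℂ)‖ ^ 2) = c := by
    rw [← mul_add, ← hsum, mul_one]
  linarith

/-- PROVED (the floor read at the bottom): `(∀ N, c ≤ ε₁^{(N)}(a)) ⇒ c ≤ ε_ev(a)`. [folklore] -/
theorem le_weilEvenGroundEnergy_of_forall_le_bottomRayleigh {a c : ℝ} (ha : 0 < a)
    (h : ∀ N : ℕ, c ≤ bottomRayleigh (zetaDatum ⟨a, N, ha⟩)) : c ≤ weilEvenGroundEnergy a :=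
  le_weilEvenGroundEnergy_of_uniform_floor ha fun N v =>
    (mul_le_mul_of_nonneg_right (h N) (dotProduct_self_nonneg_real v)).trans (bottomRayleigh_mul_le_form _ v)

/-! ## §3 `ε₁^{(N)}(a) → ε_ev(a)` monotonically from above (at `ζ`) -/

/-- **PROVED — the truncation ladder gets `δ`-close to `ε_ev(a)`:** for every `δ > 0` some truncation has
`ε₁^{(N)}(a) < ε_ev(a) + δ`. [folklore] -/
theorem exists_bottomRayleigh_lt {a : ℝ} (ha : 0 < a) {δ : ℝ} (hδ : 0 < δ) :
    ∃ N : ℕ, bottomRayleigh (zetaDatum ⟨a, N, ha⟩) < weilEvenGroundEnergy a + δ := by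
  by_contra h
  have h' : ∀ N : ℕ, weilEvenGroundEnergy a + δ ≤ bottomRayleigh (zetaDatum ⟨a, N, ha⟩) := fun N =>
    not_lt.1 fun hlt => h ⟨N, hlt⟩
  have := le_weilEvenGroundEnergy_of_forall_le_bottomRayleigh ha h'
  linarith

/-- **PROVED — GAL-2, ENERGY HALF: `ε₁^{(N)}(a) → ε_ev(a)` as `N → ∞`** (from above, monotonically), for
every half-length `a > 0`. [folklore] -/
theorem tendsto_bottomRayleigh_weilEvenGroundEnergy {a : ℝ} (ha : 0 < a) :
    Tendsto (fun N : ℕ ↦ bottomRayleigh (zetaDatum ⟨a, N, ha⟩)) atTop (𝓝 (weilEvenGroundEnergy a)) := by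
  rw [tendsto_order]
  refine ⟨fun b hb => Eventually.of_forall fun N => ?_, fun b hb => ?_⟩
  · exact hb.trans_le (weilEvenGroundEnergy_le_bottomRayleigh' ⟨a, N, ha⟩)
  · obtain ⟨N₀, hN₀⟩ := exists_bottomRayleigh_lt ha (sub_pos.2 hb)
    refine eventually_atTop.2 ⟨N₀, fun N hN => ?_⟩
    have hmono := zeta_bottomRayleigh_le_of_le ha hN
    linarith

/-- PROVED: the ladder is bounded below (by `ε_ev(a)`). [folklore] -/
theorem bddBelow_range_bottomRayleigh {a : ℝ} (ha : 0 < a) :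
    BddBelow (Set.range fun N : ℕ ↦ bottomRayleigh (zetaDatum ⟨a, N, ha⟩)) := by
  refine ⟨weilEvenGroundEnergy a, ?_⟩
  rintro r ⟨N, rfl⟩
  exact weilEvenGroundEnergy_le_bottomRayleigh' ⟨a, N, ha⟩

/-- **PROVED — `⨅_N ε₁^{(N)}(a) = ε_ev(a)`:** the continuum even ground energy is the infimum of the served
truncation ladder. [folklore] -/
theorem iInf_bottomRayleigh_eq_weilEvenGroundEnergy {a : ℝ} (ha : 0 < a) :
    ⨅ N : ℕ, bottomRayleigh (zetaDatum ⟨a, N, ha⟩) = weilEvenGroundEnergy a :=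
  tendsto_nhds_unique (tendsto_atTop_ciInf (zeta_bottomRayleigh_antitone a ha) (bddBelow_range_bottomRayleigh ha))
    (tendsto_bottomRayleigh_weilEvenGroundEnergy ha)

/-- PROVED: every rung is an upper bound, `ε_ev(a) ≤ ε₁^{(N)}(a)` (restated in the ladder's variables for
readers of this file; this is `weilEvenGroundEnergy_le_bottomRayleigh'`). [folklore] -/
theorem weilEvenGroundEnergy_le_bottomRayleigh_rung {a : ℝ} (ha : 0 < a) (N : ℕ) :
    weilEvenGroundEnergy a ≤ bottomRayleigh (zetaDatum ⟨a, N, ha⟩) :=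
  weilEvenGroundEnergy_le_bottomRayleigh' ⟨a, N, ha⟩

/-- **PROVED — along any subsequence of truncations the bottom values still converge to `ε_ev(a)`.** [folklore] -/
theorem tendsto_bottomRayleigh_comp_strictMono {a : ℝ} (ha : 0 < a) {φ : ℕ → ℕ} (hφ : StrictMono φ) :
    Tendsto (fun n : ℕ ↦ bottomRayleigh (zetaDatum ⟨a, φ n, ha⟩)) atTop (𝓝 (weilEvenGroundEnergy a)) :=
  (tendsto_bottomRayleigh_weilEvenGroundEnergy ha).comp hφ.tendsto_atTop

/-- **PROVED — the form at a bottom vector of the rank-`N` block, read against `ε_ev(a)`:**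
`ε_ev(a) · uᵀu ≤ uᵀ(ζ-block)u = ε₁^{(N)}(a) · uᵀu`. [folklore] -/
theorem form_eq_and_ge_of_isBottomVector {a : ℝ} (ha : 0 < a) {N : ℕ} {u : Fin (N + 1) → ℝ}
    (hu : IsBottomVector (zetaDatum ⟨a, N, ha⟩) u) :
    u ⬝ᵥ (zetaDatum ⟨a, N, ha⟩ *ᵥ u) = bottomRayleigh (zetaDatum ⟨a, N, ha⟩) * (u ⬝ᵥ u) ∧
      weilEvenGroundEnergy a * (u ⬝ᵥ u) ≤ u ⬝ᵥ (zetaDatum ⟨a, N, ha⟩ *ᵥ u) :=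
  ⟨by rw [hu.2, dotProduct_smul, smul_eq_mul],
    (mul_le_mul_of_nonneg_right (weilEvenGroundEnergy_le_bottomRayleigh_rung ha N) (dotProduct_self_nonneg_real u)).trans
      (bottomRayleigh_mul_le_form _ u)⟩

end Summit.RiemannHypothesis.RiemannHypothesis.Theorems.PfPersistence
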